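import Summits.KontsevichZagierPeriods.KontsevichZagierPeriods.Theorems.FermatIsogenyDeepWordSectorBP6

/-! # `FermatIsogenyDeepWordSectorBP7` — part 7/7 of the mechanical ≤400-line split of `B_src.lean` (sha256 9cb321caf3c881c0…)
Source: decomp-kz lens-5 g22 DeepWordSectorB.lean v4 @d2f1e37a (levels 3/4 closed hypothesis-free, Dirichlet move proved, level 6 from the linear rung; critic CLEARED g7-5 l.1397 / g7-7 l.1406); --supports stmt-KontsevichZagierPeriods-3898.
Split by census-1 g10 `gen/splitlean.py`: scopes re-opened with their `open`/`variable`/`set_option` context; mathematics and declaration order unchanged. -/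

noncomputable section
namespace Summit.KontsevichZagierPeriods.FermatIsogeny.DeepTargets
open Literature.NumberTheory.Transcendental MeasureTheory
open Summit.KontsevichZagierPeriods.KontsevichZagierPeriods.Theses.FermatIsogeny (BetaLinearSector BetaProductSector FermatSectorComplete)
open Literature.NumberTheory.Transcendental MeasureTheory in
open Summit.KontsevichZagierPeriods.KontsevichZagierPeriods.Theses.FermatIsogeny (BetaLinearSector BetaProductSector FermatSectorComplete) in
/-- Auxiliary step `sqrt_three_pos`: sqrt three pos. [bookkeeping] -/
private theorem sqrt_three_pos : 0 < Real.sqrt 3 := Real.sqrt_pos.mpr (by norm_num)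

section LevelSixChains

/-- exponent of `X = β(½,½)`. [bookkeeping] -/
def xExp6 (x y : Fin 6) : ℕ :=
  if (x.val = 0 ∧ y.val = 4) ∨ (x.val = 4 ∧ y.val = 0) ∨ (x.val = 1 ∧ y.val = 3) ∨ (x.val = 3 ∧ y.val = 1)
    ∨ (x.val = 2 ∧ y.val = 2) then 1 else 0
/-- exponent of `A = β(⅓,½)`. [bookkeeping] -/
def yExp6 (x y : Fin 6) : ℕ :=
  if (x.val = 0 ∧ y.val = 0) ∨ (x.val = 0 ∧ y.val = 1) ∨ (x.val = 1 ∧ y.val = 0) ∨ (x.val = 0 ∧ y.val = 2)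
    ∨ (x.val = 2 ∧ y.val = 0) ∨ (x.val = 0 ∧ y.val = 3) ∨ (x.val = 3 ∧ y.val = 0) ∨ (x.val = 1 ∧ y.val = 1)
    ∨ (x.val = 1 ∧ y.val = 2) ∨ (x.val = 2 ∧ y.val = 1) then 1 else 0
/-- exponent of `C = β(⅔,½)`. [bookkeeping] -/
def zExp6 (x y : Fin 6) : ℕ :=
  if (x.val = 1 ∧ y.val = 4) ∨ (x.val = 4 ∧ y.val = 1) ∨ (x.val = 2 ∧ y.val = 3) ∨ (x.val = 3 ∧ y.val = 2)
    ∨ (x.val = 2 ∧ y.val = 4) ∨ (x.val = 4 ∧ y.val = 2) ∨ (x.val = 3 ∧ y.val = 3) ∨ (x.val = 3 ∧ y.val = 4)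
    ∨ (x.val = 4 ∧ y.val = 3) ∨ (x.val = 4 ∧ y.val = 4) then 1 else 0
/-- exponent of `κ(√3)`. [bookkeeping] -/
def rExp6 (x y : Fin 6) : ℕ :=
  if (x.val = 0 ∧ y.val = 0) ∨ (x.val = 0 ∧ y.val = 2) ∨ (x.val = 2 ∧ y.val = 0) ∨ (x.val = 1 ∧ y.val = 3)
    ∨ (x.val = 3 ∧ y.val = 1) ∨ (x.val = 2 ∧ y.val = 4) ∨ (x.val = 4 ∧ y.val = 2) ∨ (x.val = 4 ∧ y.val = 4) then 1 else 0
/-- exponent of `κ(W)`, `W = 2^{1/3}`. [bookkeeping] -/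
def wExp6 (x y : Fin 6) : ℕ :=
  if (x.val = 0 ∧ y.val = 0) ∨ (x.val = 0 ∧ y.val = 3) ∨ (x.val = 3 ∧ y.val = 0) ∨ (x.val = 3 ∧ y.val = 3) then 2
  else if (x.val = 1 ∧ y.val = 1) ∨ (x.val = 1 ∧ y.val = 4) ∨ (x.val = 4 ∧ y.val = 1) ∨ (x.val = 4 ∧ y.val = 4) then 1 else 0
/-- the rational constant of a letter. [bookkeeping] -/
def cst6 (x y : Fin 6) : ℚ :=
  if (x.val = 0 ∧ y.val = 1) ∨ (x.val = 1 ∧ y.val = 0) ∨ (x.val = 0 ∧ y.val = 4) ∨ (x.val = 4 ∧ y.val = 0)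
    ∨ (x.val = 2 ∧ y.val = 5) ∨ (x.val = 5 ∧ y.val = 2) then 2
  else if (x.val = 1 ∧ y.val = 3) ∨ (x.val = 3 ∧ y.val = 1) ∨ (x.val = 3 ∧ y.val = 4) ∨ (x.val = 4 ∧ y.val = 3) then 2/3
  else if (x.val = 2 ∧ y.val = 4) ∨ (x.val = 4 ∧ y.val = 2) ∨ (x.val = 3 ∧ y.val = 3) then 1/2
  else if (x.val = 4 ∧ y.val = 4) then 1/4
  else if (x.val = 0 ∧ y.val = 5) ∨ (x.val = 5 ∧ y.val = 0) then 6
  else if (x.val = 1 ∧ y.val = 5) ∨ (x.val = 5 ∧ y.val = 1) then 3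
  else if (x.val = 3 ∧ y.val = 5) ∨ (x.val = 5 ∧ y.val = 3) then 3/2
  else if (x.val = 4 ∧ y.val = 5) ∨ (x.val = 5 ∧ y.val = 4) then 6/5 else 1

/-- Auxiliary definition `xCount6`: x Count6. [bookkeeping] -/
def xCount6 {k : ℕ} (u v : Fin k → Fin 6) : ℕ := ∑ i, xExp6 (u i) (v i)
/-- Auxiliary definition `yCount6`: y Count6. [bookkeeping] -/
def yCount6 {k : ℕ} (u v : Fin k → Fin 6) : ℕ := ∑ i, yExp6 (u i) (v i)
/-- Auxiliary definition `zCount6`: z Count6. [bookkeeping] -/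
def zCount6 {k : ℕ} (u v : Fin k → Fin 6) : ℕ := ∑ i, zExp6 (u i) (v i)
/-- Auxiliary definition `rCount6`: r Count6. [bookkeeping] -/
def rCount6 {k : ℕ} (u v : Fin k → Fin 6) : ℕ := ∑ i, rExp6 (u i) (v i)
/-- Auxiliary definition `wCount6`: w Count6. [bookkeeping] -/
def wCount6 {k : ℕ} (u v : Fin k → Fin 6) : ℕ := ∑ i, wExp6 (u i) (v i)
/-- Auxiliary definition `cstW6`: cst W6. [bookkeeping] -/
def cstW6 {k : ℕ} (u v : Fin k → Fin 6) : ℚ := ∏ i, cst6 (u i) (v i)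

/-- Auxiliary step `lvl_six_val`: lvl six val. [bookkeeping] -/
theorem lvl_six_val {k : ℕ} (w : Fin k → Fin 6) (i : Fin k) :
    lvl 6 w i = if (w i).val = 0 then 1/6 else if (w i).val = 1 then 1/3 else if (w i).val = 2 then 1/2
      else if (w i).val = 3 then 2/3 else if (w i).val = 4 then 5/6 else 1 := by
  unfold lvl
  have hlt := (w i).isLt
  split_ifs with h0 h1 h2 h3 h4
  · rw [h0]; norm_num
  · rw [h1]; norm_num
  · rw [h2]; norm_num
  · rw [h3]; norm_num
  · rw [h4]; norm_num
  · have h5 : (w i).val = 5 := by omega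
    rw [h5]; norm_num

set_option linter.unusedSimpArgs false in
/-- **The level-6 letters in `P`** (modulo the linear rung): `β((x+1)/6,(y+1)/6) = κ(c)·κ(√3)^r·κ(W)^w·X^{[X]}·A^{[A]}·C^{[C]}`.
[this node] -/
theorem letter_six (h6 : BetaLinearSixths) {k : ℕ} (u v : Fin k → Fin 6) (i : Fin k) :
    bcl (lvl 6 u i) (lvl 6 v i) = kcQ (cst6 (u i) (v i)) * kcR ^ rExp6 (u i) (v i) * kcW ^ wExp6 (u i) (v i)
      * (bcl (1/2) (1/2) ^ xExp6 (u i) (v i) * bcl (1/3) (1/2) ^ yExp6 (u i) (v i)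
        * bcl (2/3) (1/2) ^ zExp6 (u i) (v i)) := by
  rw [lvl_six_val u i, lvl_six_val v i]
  have hu := (u i).isLt
  have hv := (v i).isLt
  have hu' : (u i).val = 0 ∨ (u i).val = 1 ∨ (u i).val = 2 ∨ (u i).val = 3 ∨ (u i).val = 4 ∨ (u i).val = 5 := by omega
  have hv' : (v i).val = 0 ∨ (v i).val = 1 ∨ (v i).val = 2 ∨ (v i).val = 3 ∨ (v i).val = 4 ∨ (v i).val = 5 := by omega
  rcases hu' with h | h | h | h | h | h <;> rcases hv' with h' | h' | h' | h' | h' | h' <;>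
    simp only [h, h', cst6, xExp6, yExp6, zExp6, rExp6, wExp6, if_true, if_false, and_true, and_false, true_and, false_and,
      or_false, or_true, false_or, true_or, pow_one, pow_zero, mul_one, one_mul, kcQ_one,
      show (0:ℕ) ≠ 1 from by decide, show (0:ℕ) ≠ 2 from by decide, show (0:ℕ) ≠ 3 from by decide,
      show (0:ℕ) ≠ 4 from by decide, show (0:ℕ) ≠ 5 from by decide,
      show (1:ℕ) ≠ 0 from by decide, show (1:ℕ) ≠ 2 from by decide, show (1:ℕ) ≠ 3 from by decide,
      show (1:ℕ) ≠ 4 from by decide, show (1:ℕ) ≠ 5 from by decide,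
      show (2:ℕ) ≠ 0 from by decide, show (2:ℕ) ≠ 1 from by decide, show (2:ℕ) ≠ 3 from by decide,
      show (2:ℕ) ≠ 4 from by decide, show (2:ℕ) ≠ 5 from by decide,
      show (3:ℕ) ≠ 0 from by decide, show (3:ℕ) ≠ 1 from by decide, show (3:ℕ) ≠ 2 from by decide,
      show (3:ℕ) ≠ 4 from by decide, show (3:ℕ) ≠ 5 from by decide,
      show (4:ℕ) ≠ 0 from by decide, show (4:ℕ) ≠ 1 from by decide, show (4:ℕ) ≠ 2 from by decide,
      show (4:ℕ) ≠ 3 from by decide, show (4:ℕ) ≠ 5 from by decide,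
      show (5:ℕ) ≠ 0 from by decide, show (5:ℕ) ≠ 1 from by decide, show (5:ℕ) ≠ 2 from by decide,
      show (5:ℕ) ≠ 3 from by decide, show (5:ℕ) ≠ 4 from by decide,
      bcl6_11 h6, bcl6_12 h6, bcl6_21 h6, bcl6_13 h6, bcl6_31 h6, bcl6_14 h6, bcl6_41 h6, bcl6_15 h6, bcl6_51 h6,
      bcl6_22 h6, bcl6_24 h6, bcl6_42 h6, bcl6_25 h6, bcl6_52 h6, bcl6_35 h6, bcl6_53 h6, bcl6_44 h6, bcl6_45 h6,
      bcl6_54 h6, bcl6_55 h6, bcl_half_third, bcl_half_twoThirds,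
      bcl_sixth_one, bcl_one_sixth, bcl_third_one, bcl_one_third, bcl_half_one', bcl_one_half', bcl_twoThirds_one,
      bcl_one_twoThirds, bcl_fiveSixths_one, bcl_one_fiveSixths, bcl_one_one]

/-- **A level-6 word in `P`** (modulo the linear rung): `∏ᵢ β = κ(∏ c)·κ(√3)^{#r}·κ(W)^{#w}·(X^{#X}·A^{#A}·C^{#C})`. [this node] -/
theorem word_class_six (h6 : BetaLinearSixths) {k : ℕ} (u v : Fin k → Fin 6) :
    ∏ i, bcl (lvl 6 u i) (lvl 6 v i)
      = kcQ (cstW6 u v) * kcR ^ rCount6 u v * kcW ^ wCount6 u v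
        * (bcl (1/2) (1/2) ^ xCount6 u v * bcl (1/3) (1/2) ^ yCount6 u v * bcl (2/3) (1/2) ^ zCount6 u v) := by
  simp_rw [letter_six h6 u v]
  rw [Finset.prod_mul_distrib, Finset.prod_mul_distrib, Finset.prod_mul_distrib, Finset.prod_mul_distrib,
    Finset.prod_mul_distrib, Finset.prod_pow_eq_pow_sum, Finset.prod_pow_eq_pow_sum, Finset.prod_pow_eq_pow_sum,
    Finset.prod_pow_eq_pow_sum, Finset.prod_pow_eq_pow_sum, kcQ_prod]
  rfl

/-- **Values of level-6 words** (modulo the linear rung). [this node] -/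
theorem prod_bval_six (h6 : BetaLinearSixths) {k : ℕ} (u v : Fin k → Fin 6) :
    ∏ i, bval (lvl 6 u i) (lvl 6 v i)
      = (cstW6 u v : ℝ) * Real.sqrt 3 ^ rCount6 u v * cW ^ wCount6 u v
        * (bval (1/2) (1/2) ^ xCount6 u v * bval (1/3) (1/2) ^ yCount6 u v * bval (2/3) (1/2) ^ zCount6 u v) := by
  have h := congrArg KZ.evalP (word_class_six h6 u v)
  rw [map_prod, map_mul, map_mul, map_mul, map_mul, map_mul, map_pow, map_pow, map_pow, map_pow, map_pow,
    evalP_kcQ, evalP_kcR, evalP_kcW] at h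
  exact h

/-! #### DKO type 0 at level 6 in terms of letter counts -/

/-- Auxiliary step `letterInv_six_a`: letter Inv six a. [bookkeeping] -/
theorem letterInv_six_a (x y : Fin 6) :
    letterMult 6 x y 1 + letterMult 6 x y 2 + letterMult 6 x y 3 + letterMult 6 x y 4 + letterMult 6 x y 5
      = 2 * (xExp6 x y : ℤ) + yExp6 x y + zExp6 x y := by
  fin_cases x <;> fin_cases y <;> decide

/-- Auxiliary step `letterInv_six_b`: letter Inv six b. [bookkeeping] -/
theorem letterInv_six_b (x y : Fin 6) :
    letterMult 6 x y 1 + 2 * letterMult 6 x y 2 + 3 * letterMult 6 x y 3 + 4 * letterMult 6 x y 4 + 5 * letterMult 6 x y 5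
      = 6 * (xExp6 x y : ℤ) + 6 * zExp6 x y := by
  fin_cases x <;> fin_cases y <;> decide

/-- Auxiliary step `sum_letterMult_six_a`: sum letter Mult six a. [bookkeeping] -/
theorem sum_letterMult_six_a {k : ℕ} (u v : Fin k → Fin 6) :
    ∑ j, letterMult 6 (u j) (v j) 1 + ∑ j, letterMult 6 (u j) (v j) 2 + ∑ j, letterMult 6 (u j) (v j) 3
      + ∑ j, letterMult 6 (u j) (v j) 4 + ∑ j, letterMult 6 (u j) (v j) 5
      = 2 * (xCount6 u v : ℤ) + (yCount6 u v : ℤ) + (zCount6 u v : ℤ) := by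
  simp only [xCount6, yCount6, zCount6, Nat.cast_sum, Finset.mul_sum, ← Finset.sum_add_distrib]
  exact Finset.sum_congr rfl fun j _ => by linarith [letterInv_six_a (u j) (v j)]

/-- Auxiliary step `sum_letterMult_six_b`: sum letter Mult six b. [bookkeeping] -/
theorem sum_letterMult_six_b {k : ℕ} (u v : Fin k → Fin 6) :
    ∑ j, letterMult 6 (u j) (v j) 1 + 2 * ∑ j, letterMult 6 (u j) (v j) 2 + 3 * ∑ j, letterMult 6 (u j) (v j) 3
      + 4 * ∑ j, letterMult 6 (u j) (v j) 4 + 5 * ∑ j, letterMult 6 (u j) (v j) 5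
      = 6 * (xCount6 u v : ℤ) + 6 * (zCount6 u v : ℤ) := by
  simp only [xCount6, zCount6, Nat.cast_sum, Finset.mul_sum, ← Finset.sum_add_distrib]
  exact Finset.sum_congr rfl fun j _ => by linarith [letterInv_six_b (u j) (v j)]

/-- Auxiliary step `fract_six`: fract six. [bookkeeping] -/
theorem fract_six (w i : ℕ) :
    Int.fract ((w : ℚ) * (i : ℚ) / ((6 : ℕ) : ℚ)) = (((w * i) % 6 : ℕ) : ℚ) / ((6 : ℕ) : ℚ) := by
  rw [show (w : ℚ) * (i : ℚ) / ((6 : ℕ) : ℚ) = ((w * i : ℕ) : ℚ) / ((6 : ℕ) : ℚ) by push_cast; ring]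
  exact Int.fract_div_natCast_eq_div_natCast_mod

/-- At level 6 a Γ-vector has DKO type 0 iff `Σ nᵢ = 0` and `Σ i·nᵢ = 0` (units `1, 5 (mod 6)`). [this node] -/
theorem hodgeType_six_iff (p : ℕ → ℤ) :
    IsHodgeTypeGammaMonomial 6 p 0 ↔
      (p 1 + p 2 + p 3 + p 4 + p 5 = 0 ∧ p 1 + 2 * p 2 + 3 * p 3 + 4 * p 4 + 5 * p 5 = 0) := by
  constructor
  · intro h
    have e1 := h 1 (by decide)
    have e5 := h 5 (by decide)
    rw [sum_Ico_one_six, fract_six, fract_six, fract_six, fract_six, fract_six] at e1 e5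
    norm_num at e1 e5
    have i1 : ((p 1 : ℤ) : ℚ) + p 2 + p 3 + p 4 + p 5 = 0 := by linarith
    have i2 : ((p 1 : ℤ) : ℚ) + 2 * p 2 + 3 * p 3 + 4 * p 4 + 5 * p 5 = 0 := by linarith
    exact ⟨by exact_mod_cast i1, by exact_mod_cast i2⟩
  · rintro ⟨h1, h2⟩ w hw
    rw [sum_Ico_one_six, fract_six, fract_six, fract_six, fract_six, fract_six]
    have q1 : ((p 1 : ℤ) : ℚ) + p 2 + p 3 + p 4 + p 5 = 0 := by exact_mod_cast h1
    have q2 : ((p 1 : ℤ) : ℚ) + 2 * p 2 + 3 * p 3 + 4 * p 4 + 5 * p 5 = 0 := by exact_mod_cast h2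
    have hw' : w % 6 = 1 ∨ w % 6 = 5 := by
      have h2 : ¬ 2 ∣ w := fun hd => absurd (Nat.Coprime.coprime_dvd_left hd hw) (by decide)
      have h3 : ¬ 3 ∣ w := fun hd => absurd (Nat.Coprime.coprime_dvd_left hd hw) (by decide)
      omega
    rcases hw' with hw1 | hw5
    · have a1 : (w * 1) % 6 = 1 := by omega
      have a2 : (w * 2) % 6 = 2 := by omega
      have a3 : (w * 3) % 6 = 3 := by omega
      have a4 : (w * 4) % 6 = 4 := by omega
      have a5 : (w * 5) % 6 = 5 := by omega
      rw [a1, a2, a3, a4, a5]; push_cast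
      linear_combination q2 / 6
    · have a1 : (w * 1) % 6 = 5 := by omega
      have a2 : (w * 2) % 6 = 4 := by omega
      have a3 : (w * 3) % 6 = 3 := by omega
      have a4 : (w * 4) % 6 = 2 := by omega
      have a5 : (w * 5) % 6 = 1 := by omega
      rw [a1, a2, a3, a4, a5]; push_cast
      linear_combination q1 - q2 / 6

/-- **DKO type 0 at level 6 = the two count identities of `nf3`**: `#X + #C` and `#A − #C` agree. [this node] -/
theorem sameType_six_iff {k : ℕ} (u v u' v' : Fin k → Fin 6) :
    SameType 6 u v u' v' ↔
      (xCount6 u v + zCount6 u v = xCount6 u' v' + zCount6 u' v' ∧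
        yCount6 u v + zCount6 u' v' = yCount6 u' v' + zCount6 u v) := by
  have ha := sum_letterMult_six_a u v
  have ha' := sum_letterMult_six_a u' v'
  have hb := sum_letterMult_six_b u v
  have hb' := sum_letterMult_six_b u' v'
  unfold SameType
  rw [hodgeType_six_iff]
  simp only [pairMult]
  omega

/-! #### the chain theorem at level 6 -/

/-- **LEVEL-6 CHAINS FROM THE LINEAR RUNG**: `BetaLinearSixths → BoxChain k 6 (SameType 6)` for every word length `k` —
"linear (`k = 1`) ⇒ all word lengths" at level 6. [this node] -/
theorem boxChain_six_of_linear (h6 : BetaLinearSixths) (k : ℕ) : BoxChain k 6 (SameType 6) := by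
  intro u v u' v' hT q hq r r' hr hi hr' hi' hv
  have hN : (0:ℕ) < 6 := by norm_num
  have hab : ∀ j, 0 < lvl 6 u j ∧ 0 < lvl 6 v j := fun j => ⟨(lvl_bounds hN u j).1, (lvl_bounds hN v j).1⟩
  have hab' : ∀ j, 0 < lvl 6 u' j ∧ 0 < lvl 6 v' j := fun j => ⟨(lvl_bounds hN u' j).1, (lvl_bounds hN v' j).1⟩
  obtain ⟨hxz, hyz⟩ := (sameType_six_iff u v u' v').mp hT
  -- values
  have vX : 0 < bval (1/2) (1/2) := bval_pos (by norm_num) (by norm_num)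
  have vA : 0 < bval (1/3) (1/2) := bval_pos (by norm_num) (by norm_num)
  have vC : 0 < bval (2/3) (1/2) := bval_pos (by norm_num) (by norm_num)
  have vR : 0 < Real.sqrt 3 := sqrt_three_pos
  have vW : 0 < cW := cW_pos
  have vT : 0 < 2 * Real.sqrt 3 := twoSqrtThree_pos
  have vr : r.value = (cstW6 u v : ℝ) * Real.sqrt 3 ^ rCount6 u v * cW ^ wCount6 u v
      * (bval (1/2) (1/2) ^ xCount6 u v * bval (1/3) (1/2) ^ yCount6 u v * bval (2/3) (1/2) ^ zCount6 u v) := by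
    rw [word_value _ _ hab r hr hi, prod_bval_six h6]
  have vr' : r'.value = q * ((cstW6 u' v' : ℝ) * Real.sqrt 3 ^ rCount6 u' v' * cW ^ wCount6 u' v'
      * (bval (1/2) (1/2) ^ xCount6 u' v' * bval (1/3) (1/2) ^ yCount6 u' v' * bval (2/3) (1/2) ^ zCount6 u' v')) := by
    rw [word_value_const q hq _ _ hab' r' hr' hi', prod_bval_six h6]
  have hWv : (2 * Real.sqrt 3) ^ zCount6 u' v' * (bval (1/2) (1/2) ^ xCount6 u v * bval (1/3) (1/2) ^ yCount6 u v * bval (2/3) (1/2) ^ zCount6 u v)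
      = (2 * Real.sqrt 3) ^ zCount6 u v * (bval (1/2) (1/2) ^ xCount6 u' v' * bval (1/3) (1/2) ^ yCount6 u' v' * bval (2/3) (1/2) ^ zCount6 u' v') :=
    nf3 (relation_six_values h6) hxz hyz
  have hW0 : (2 * Real.sqrt 3) ^ zCount6 u' v' * (bval (1/2) (1/2) ^ xCount6 u v * bval (1/3) (1/2) ^ yCount6 u v * bval (2/3) (1/2) ^ zCount6 u v) ≠ 0 := by
    positivity
  -- the constants: `c·√3^r·W^w·T^z = q·c'·√3^{r'}·W^{w'}·T^{z'}`
  have key : ((cstW6 u v : ℝ) * Real.sqrt 3 ^ rCount6 u v * cW ^ wCount6 u v) * (2 * Real.sqrt 3) ^ zCount6 u v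
      = q * ((cstW6 u' v' : ℝ) * Real.sqrt 3 ^ rCount6 u' v' * cW ^ wCount6 u' v') * (2 * Real.sqrt 3) ^ zCount6 u' v' := by
    have e : ((cstW6 u v : ℝ) * Real.sqrt 3 ^ rCount6 u v * cW ^ wCount6 u v)
          * (bval (1/2) (1/2) ^ xCount6 u v * bval (1/3) (1/2) ^ yCount6 u v * bval (2/3) (1/2) ^ zCount6 u v)
        = q * ((cstW6 u' v' : ℝ) * Real.sqrt 3 ^ rCount6 u' v' * cW ^ wCount6 u' v')
          * (bval (1/2) (1/2) ^ xCount6 u' v' * bval (1/3) (1/2) ^ yCount6 u' v' * bval (2/3) (1/2) ^ zCount6 u' v') := by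
      have := hv; rw [vr, vr'] at this; linear_combination this
    apply mul_right_cancel₀ hW0
    calc ((cstW6 u v : ℝ) * Real.sqrt 3 ^ rCount6 u v * cW ^ wCount6 u v) * (2 * Real.sqrt 3) ^ zCount6 u v
            * ((2 * Real.sqrt 3) ^ zCount6 u' v' * (bval (1/2) (1/2) ^ xCount6 u v * bval (1/3) (1/2) ^ yCount6 u v * bval (2/3) (1/2) ^ zCount6 u v))
          = (((cstW6 u v : ℝ) * Real.sqrt 3 ^ rCount6 u v * cW ^ wCount6 u v)
              * (bval (1/2) (1/2) ^ xCount6 u v * bval (1/3) (1/2) ^ yCount6 u v * bval (2/3) (1/2) ^ zCount6 u v))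
            * (2 * Real.sqrt 3) ^ zCount6 u v * (2 * Real.sqrt 3) ^ zCount6 u' v' := by ring
      _ = (q * ((cstW6 u' v' : ℝ) * Real.sqrt 3 ^ rCount6 u' v' * cW ^ wCount6 u' v')
              * (bval (1/2) (1/2) ^ xCount6 u' v' * bval (1/3) (1/2) ^ yCount6 u' v' * bval (2/3) (1/2) ^ zCount6 u' v'))
            * (2 * Real.sqrt 3) ^ zCount6 u v * (2 * Real.sqrt 3) ^ zCount6 u' v' := by rw [e]
      _ = q * ((cstW6 u' v' : ℝ) * Real.sqrt 3 ^ rCount6 u' v' * cW ^ wCount6 u' v') * (2 * Real.sqrt 3) ^ zCount6 u' v'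
            * ((2 * Real.sqrt 3) ^ zCount6 u v * (bval (1/2) (1/2) ^ xCount6 u' v' * bval (1/3) (1/2) ^ yCount6 u' v' * bval (2/3) (1/2) ^ zCount6 u' v')) := by ring
      _ = q * ((cstW6 u' v' : ℝ) * Real.sqrt 3 ^ rCount6 u' v' * cW ^ wCount6 u' v') * (2 * Real.sqrt 3) ^ zCount6 u' v'
            * ((2 * Real.sqrt 3) ^ zCount6 u' v' * (bval (1/2) (1/2) ^ xCount6 u v * bval (1/3) (1/2) ^ yCount6 u v * bval (2/3) (1/2) ^ zCount6 u v)) := by rw [hWv]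
  -- classes
  have hWP : kcT6 ^ zCount6 u' v' * (bcl (1/2) (1/2) ^ xCount6 u v * bcl (1/3) (1/2) ^ yCount6 u v * bcl (2/3) (1/2) ^ zCount6 u v)
      = kcT6 ^ zCount6 u v * (bcl (1/2) (1/2) ^ xCount6 u' v' * bcl (1/3) (1/2) ^ yCount6 u' v' * bcl (2/3) (1/2) ^ zCount6 u' v') :=
    nf3 (relation_six h6) hxz hyz
  have hW2 : (bcl (1/2) (1/2) ^ xCount6 u' v' * bcl (1/3) (1/2) ^ yCount6 u' v' * bcl (2/3) (1/2) ^ zCount6 u' v')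
      = kcT6i ^ zCount6 u v * kcT6 ^ zCount6 u' v' * (bcl (1/2) (1/2) ^ xCount6 u v * bcl (1/3) (1/2) ^ yCount6 u v * bcl (2/3) (1/2) ^ zCount6 u v) := by
    calc (bcl (1/2) (1/2) ^ xCount6 u' v' * bcl (1/3) (1/2) ^ yCount6 u' v' * bcl (2/3) (1/2) ^ zCount6 u' v')
          = (kcT6 * kcT6i) ^ zCount6 u v * (bcl (1/2) (1/2) ^ xCount6 u' v' * bcl (1/3) (1/2) ^ yCount6 u' v' * bcl (2/3) (1/2) ^ zCount6 u' v') := by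
            rw [kcT6_mul_kcT6i, one_pow, one_mul]
      _ = kcT6i ^ zCount6 u v * (kcT6 ^ zCount6 u v * (bcl (1/2) (1/2) ^ xCount6 u' v' * bcl (1/3) (1/2) ^ yCount6 u' v' * bcl (2/3) (1/2) ^ zCount6 u' v')) := by
            rw [mul_pow]; ring
      _ = kcT6i ^ zCount6 u v * (kcT6 ^ zCount6 u' v' * (bcl (1/2) (1/2) ^ xCount6 u v * bcl (1/3) (1/2) ^ yCount6 u v * bcl (2/3) (1/2) ^ zCount6 u v)) := by
            rw [hWP]
      _ = _ := by ring
  have er : KZ.toFormalPeriod (KZ.of r) = (kcQ (cstW6 u v) * kcR ^ rCount6 u v * kcW ^ wCount6 u v)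
      * (bcl (1/2) (1/2) ^ xCount6 u v * bcl (1/3) (1/2) ^ yCount6 u v * bcl (2/3) (1/2) ^ zCount6 u v) := by
    rw [word_class _ _ hab r hr hi, word_class_six h6]
  have er' : KZ.toFormalPeriod (KZ.of r')
      = (kc q hq * (kcQ (cstW6 u' v') * kcR ^ rCount6 u' v' * kcW ^ wCount6 u' v') * kcT6i ^ zCount6 u v * kcT6 ^ zCount6 u' v')
        * (bcl (1/2) (1/2) ^ xCount6 u v * bcl (1/3) (1/2) ^ yCount6 u v * bcl (2/3) (1/2) ^ zCount6 u v) := by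
    rw [word_class_const q hq _ _ hab' r' hr' hi', word_class_six h6, hW2]; ring
  have hsc : kc q hq * (kcQ (cstW6 u' v') * kcR ^ rCount6 u' v' * kcW ^ wCount6 u' v') * kcT6i ^ zCount6 u v * kcT6 ^ zCount6 u' v'
      = kcQ (cstW6 u v) * kcR ^ rCount6 u v * kcW ^ wCount6 u v := by
    rw [kcQ, kcQ, kcR, kcW, kcT6, kcT6i, kc_pow, kc_pow, kc_pow, kc_pow, kc_pow, kc_pow,
      ← kc_mul, ← kc_mul, ← kc_mul, ← kc_mul, ← kc_mul, ← kc_mul, ← kc_mul]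
    refine kc_congr _ _ ?_
    have hTi : ((2 * Real.sqrt 3)⁻¹) ^ zCount6 u v * (2 * Real.sqrt 3) ^ zCount6 u v = 1 := by
      rw [← mul_pow, inv_mul_cancel₀ vT.ne', one_pow]
    linear_combination (-(((2 * Real.sqrt 3)⁻¹) ^ zCount6 u v)) * key
      + ((cstW6 u v : ℝ) * Real.sqrt 3 ^ rCount6 u v * cW ^ wCount6 u v) * hTi
  have e : KZ.toFormalPeriod (KZ.of r) = KZ.toFormalPeriod (KZ.of r') := by rw [er, er', hsc]
  show KZ.of r - KZ.of r' ∈ KZ.relations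
  exact KZ.toFormalPeriod_eq_iff.mp e

/-- **LEVEL 6 OF EVERY BETA-WORD SECTOR** from the linear rung and Chudnovsky's theorem for `Γ(⅓), π` (both tree theorems, typed
faithfully): `∀ k, BetaWordSectorLevel k 6`. [this node] -/
theorem betaWordSectorLevel_six_of_chudnovsky_linear (h3 : ChudnovskyGammaThird) (h6 : BetaLinearSixths) (k : ℕ) :
    BetaWordSectorLevel k 6 :=
  (betaWordSectorLevel_three_six_iff_of_chudnovsky h3 k).2.mpr (boxChain_six_of_linear h6 k)

/-- Same, over `GammaThirdPiIndep` (the algebraic-independence form used by `rohrlichHodgeAt_six_of`). [this node] -/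
theorem betaWordSectorLevel_six_of_indep_linear (h : GammaThirdPiIndep) (h6 : BetaLinearSixths) (k : ℕ) :
    BetaWordSectorLevel k 6 :=
  (betaWordSectorLevel_six_iff h k).mpr (boxChain_six_of_linear h6 k)

/-- **CRUX 3898 IS THE PURE ROHRLICH SHADOW `N = 5, N ≥ 7`** modulo three tree theorems pending build (Chudnovsky for `Γ(⅓), π` and
`Γ(¼), π`; the route's linear rung `betaLinearSector_sixths`): the `φ(N) ≤ 2` base range `N ∈ {3, 4, 6}` of `BetaProductSector` is
decided. [this node] -/
theorem betaProductSector_iff_shadow_of_chudnovsky_linear (h3 : ChudnovskyGammaThird) (h4 : ChudnovskyGammaQuarter)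
    (h6 : BetaLinearSixths) :
    Summit.KontsevichZagierPeriods.KontsevichZagierPeriods.Theses.FermatIsogeny.BetaProductSector ↔
      ∀ N, 3 ≤ N → N ≠ 3 → N ≠ 4 → N ≠ 6 → BetaWordSectorLevel 2 N := by
  rw [betaProductSector_iff_level_six_of_chudnovsky h3 h4]
  exact ⟨fun h => h.2, fun h => ⟨boxChain_six_of_linear h6 2, h⟩⟩

/-- The same base range stated as `N = 5 ∨ N ≥ 7`. [this node] -/
theorem betaProductSector_iff_shadow_five_seven (h3 : ChudnovskyGammaThird) (h4 : ChudnovskyGammaQuarter)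
    (h6 : BetaLinearSixths) :
    Summit.KontsevichZagierPeriods.KontsevichZagierPeriods.Theses.FermatIsogeny.BetaProductSector ↔
      ∀ N, 5 ≤ N → N ≠ 6 → BetaWordSectorLevel 2 N := by
  rw [betaProductSector_iff_shadow_of_chudnovsky_linear h3 h4 h6]
  constructor
  · intro h N h5 hn6; exact h N (by omega) (by omega) (by omega) hn6
  · intro h N h3' hn3 hn4 hn6; exact h N (by omega) hn6

/-- `Γ(⅙)Γ(⅚) = 2·Γ(½)²` on values, read off in `P` from the class identity `bcl6_15` (`β(⅙,⅚) = κ(2)·β(½,½)`). [folklore] -/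
theorem bval_sixth_fiveSixths (h6 : BetaLinearSixths) : bval (1/6) (5/6) = 2 * bval (1/2) (1/2) := by
  have h := congrArg KZ.evalP (bcl6_15 h6)
  rw [map_mul, evalP_kcQ] at h
  push_cast at h
  exact h

end LevelSixChains

end Summit.KontsevichZagierPeriods.FermatIsogeny.DeepTargets
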